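import Summits.ABC.IUTFork.Joshi.TestATS4LowerBoundGenuineRealising
import Mathlib.NumberTheory.NumberField.Cyclotomic.Ideal
import Mathlib.NumberTheory.NumberField.Cyclotomic.Basic
import Mathlib.NumberTheory.NumberField.Discriminant.Different
import HarnessLib

/-!
# R-J census, row Y-21ℓ — the REALISING countermodel over a base field CONTAINING `√−1`: `F = ℚ(ζ₂₈)`, `j_E := 3^{−10}`,
# `S := V(F)₃`, `l := 5` (the prime `7`: ONE place of `F`, `e = 6`, `f = 2`)

Proof-only record file of the abc-iut cell, branch E → R-J «Joshi Y-discharge census» (D-0079; rung LADDER-ABC:A2.RESCUE.J; seat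
abc-iut-E-t59, gen 9; part V, the second inhabitant of part III `TestATS4LowerBoundGenuineRealising.statement_and_not_cor91111_of_realising`,
after part IV's `ℚ(ζ₅)` (p473715), which LACKS `√−1`). **No side is taken** on [IUTchIII] Cor. 3.12 / [IUTchIV] Thm 1.10, on [J-III]
Cor 9.11.1.1 (unrefereed arXiv preprint) or on any author; typed ≠ proved ≠ endorsed; instantiated ≠ endorsed; no definition, no `Prop` fact.

[IUTchI] Def. 3.1 (a) asks `√−1 ∈ F` of the base field of an initial Θ-datum; at such fields every place over `2` is ramified, but the
quantitative gain at the `2`-packets alone (`≤ (3/2)·log 2` per unit of weight at `ℓ⋆ = 2`) never covers the realising gap `(3/2)·m_q·log p`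
of an odd bad prime. THIS FILE uses a prime TOTALLY RAMIFIED OVER `ℚ(√−1)` instead:
**`exists_pilotData_cyclotomicField_twentyEight_realising_hypotheses`** — over `F = ℚ(ζ₂₈) = ℚ(√−1, ζ₇)` (Mathlib's `CyclotomicField 28 ℚ`;
`[F:ℚ] = 12`; `√−1 = ζ₂₈⁷ ∈ F`; the prime `7 = 7¹·(28/4)`-part has `e = 6`, `f = ord(7 mod 4) = 2`, hence — fundamental identity
`g·e·f = 12` — exactly ONE place `v₀`, of weight `1`: Mathlib `IsCyclotomicExtension.Rat.ramificationIdx_eq` / `inertiaDegIn_eq` /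
`Ideal.ncard_primesOver_mul_ramificationIdxIn_mul_inertiaDegIn`; `3 ∤ 28` is UNRAMIFIED: `ramificationIdx_eq_of_not_dvd` +
`NumberField.not_dvd_discr_iff_forall_liesOver`, so `3 ∤ disc F`) the pilot datum `j_E := 3^{−10}`, `S := V(F)₃` (bad mass one;
`ord_v(q_v) = 10·e_v = 2·l·e_v·1`), `l := 5`, with `U = {3}`, `m_q(3) = 1`, `p₀ = 7` meets EVERY hypothesis of part III AND `√−1 ∈ F`; the window
inequality is `(3/2)·log 3 ≤ (5/6)·(3/2)·log 7 = (5/4)·log 7`, i.e. `3⁶ = 729 ≤ 7⁵ = 16807`.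
**`exists_realising_statement_and_not_cor91111_cyclotomicField_twentyEight`** — assembled: over `F = ℚ(ζ₂₈) ∋ √−1` there are a pilot
datum and a set `s` of rational places such that for EVERY Thm-3.11 context realising pilot ideles EXIST and for ALL of them OUR typed
[IUTchIII] Cor. 3.12 Statement HOLDS while [J-III] Cor 9.11.1.1 read through the dictionary FAILS for every reading datum. So the converse
of Y-21ℓ is REFUTED on print's normalisation over a base field with `√−1` (gap `(3/2)·log 3 ≈ 1.648` in a window of length
`≥ (5/4)·log 7 ≈ 2.432`). HONEST SCOPE as in parts I–IV ((Ind2) as typed at the real setting; sharp (Ind3) reading; trivial archimedean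
container; the Statement holds BY (Ind1)/(Ind2)-INFLATION of the unit boxes at the `7`-packets, «saying nothing about print's intended
content»); a PilotData-level inhabitant only (no elliptic curve `E` with `F = F_mod(E[l])…`, no `K = F(E[l])`; [IUTchIV] Thm 1.10's further
side conditions on `(F, l, E)` are not typed); vs S: S-BYPASSED (p447958). [claim: Joshi2024ATS3, status: disputed] [claim: Mochizuki2012,
status: disputed] [cite: Mochizuki2012, IUTchI Def. 3.1 (a) p. 61] [cite: DupuyHilado2025, §3.3] [cite: NeukirchANT1999, Ch. I (10.3), Ch. II Prop. (6.8)].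
Standard axioms.
-/

noncomputable section

open Set Function NumberField IsDedekindDomain Finset
open scoped Pointwise

namespace Summit.ABC.IUTFork.Joshi

open Thm311 Thm311.Real Cor312 Cor312.Setting Cor312Vol Literature.IUT.LogThetaLattice Literature.IUT.LogVolume
  Literature.IUT.HodgeTheaters Literature.NumberTheory.NumberFields

namespace TestATS4LowerBound

/-- The arithmetic of the window at `ℚ(ζ₂₈)`: `(3/2)·log 3 ≤ (5/4)·log 7` (`3⁶ ≤ 7⁵`). [folklore] -/
theorem three_halves_log_three_le_five_fourths_log_seven : (3 / 2 : ℝ) * Real.log 3 ≤ (5 / 4 : ℝ) * Real.log 7 := by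
  have h : Real.log ((3 : ℝ) ^ 6) ≤ Real.log ((7 : ℝ) ^ 5) :=
    Real.log_le_log (by positivity) (by norm_num)
  rw [Real.log_pow, Real.log_pow] at h
  push_cast at h
  linarith

/-- `√−1 ∈ ℚ(ζ₂₈)`: `(ζ₂₈⁷)² = −1`. [cite: NeukirchANT1999, Ch. I (10.3)] -/
theorem exists_sq_eq_neg_one_cyclotomicField_twentyEight : ∃ r : CyclotomicField 28 ℚ, r ^ 2 = -1 := by
  set K := CyclotomicField 28 ℚ with hK
  haveI : IsCyclotomicExtension {28} ℚ K := CyclotomicField.isCyclotomicExtension 28 ℚ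
  have hζ := IsCyclotomicExtension.zeta_spec 28 ℚ K
  have h4 : IsPrimitiveRoot (IsCyclotomicExtension.zeta 28 ℚ K ^ 7) 4 := hζ.pow (by norm_num) (by norm_num)
  refine ⟨IsCyclotomicExtension.zeta 28 ℚ K ^ 7, ?_⟩
  have hne : (IsCyclotomicExtension.zeta 28 ℚ K ^ 7) ^ 2 ≠ 1 := h4.pow_ne_one_of_pos_of_lt (by norm_num) (by norm_num)
  have hsq : (IsCyclotomicExtension.zeta 28 ℚ K ^ 7) ^ 2 * (IsCyclotomicExtension.zeta 28 ℚ K ^ 7) ^ 2 = 1 := by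
    rw [← pow_add]
    exact h4.pow_eq_one
  exact (mul_self_eq_one_iff.mp hsq).resolve_left hne

/-- **NON-VACUITY of part III over `ℚ(ζ₂₈) ∋ √−1`.** The pilot datum `j_E := 3^{−10}`, `S := V(F)₃`, `l := 5` over
`F = CyclotomicField 28 ℚ`, with `U = {3}`, `m_q(3) = 1`, `p₀ = 7` and `v₀` the place over `7`, satisfies `√−1 ∈ F` and every hypothesis of
`statement_and_not_cor91111_of_realising` / `exists_realising_ideles`: bad mass one over `U`; `3` odd and unramified; `ord_v(q_v) = 2·l·e_v·m_q`
over `3`; `7` has ONE place, of ramification index `6 ≥ 2`; and the window inequality. [cite: Mochizuki2012, IUTchI Def. 3.1 (a) p. 61]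
[cite: DupuyHilado2025, §3.3] [cite: NeukirchANT1999, Ch. I (10.3)] [claim: Mochizuki2012, status: disputed] (the pilot-object shape) -/
theorem exists_pilotData_cyclotomicField_twentyEight_realising_hypotheses :
    (∃ r : CyclotomicField 28 ℚ, r ^ 2 = -1) ∧
    ∃ (X : PilotData (CyclotomicField 28 ℚ)) (U : Finset Nat.Primes) (mq : Nat.Primes → ℕ) (p₀ : Nat.Primes)
      (v₀ : HeightOneSpectrum (𝓞 (CyclotomicField 28 ℚ))) (_ : (thetaIndex X).over (.inr v₀) = .inr p₀)
      (hvp₀ : ((p₀ : ℕ) : 𝓞 (CyclotomicField 28 ℚ)) ∈ v₀.asIdeal),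
      (∀ (pp : Nat.Primes) (x : (thetaIndex X).Fibre (.inr pp)),
        haveI : Fact (pp : ℕ).Prime := ⟨pp.2⟩; placeOf X pp.1 x ∈ X.S → pp ∈ U) ∧
      (∀ (pp : Nat.Primes), pp ∈ U → ∀ (x : (thetaIndex X).Fibre (.inr pp)),
        haveI : Fact (pp : ℕ).Prime := ⟨pp.2⟩; placeOf X pp.1 x ∈ X.S) ∧
      (∀ pp ∈ U, 2 < (pp : ℕ)) ∧ (∀ pp ∈ U, ¬ ((pp : ℕ) : ℤ) ∣ NumberField.discr (CyclotomicField 28 ℚ)) ∧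
      (∀ (pp : Nat.Primes), pp ∈ U → ∀ (x : (thetaIndex X).Fibre (.inr pp)),
        haveI : Fact (pp : ℕ).Prime := ⟨pp.2⟩;
        (X.ordq (placeOf X pp.1 x) : ℝ) = 2 * X.l * ramIdx (CyclotomicField 28 ℚ) (placeOf X pp.1 x) * mq pp) ∧
      (haveI : Fact (p₀ : ℕ).Prime := ⟨p₀.2⟩;
        2 ≤ absRamificationIdx (p₀ : ℕ) (RescaledCompletion (CyclotomicField 28 ℚ) (p₀ : ℕ) v₀ hvp₀)) ∧
      (∀ w ∈ placesOver (CyclotomicField 28 ℚ) (p₀ : ℕ), w = v₀) ∧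
      (haveI : Fact (p₀ : ℕ).Prime := ⟨p₀.2⟩;
        ((((thetaIndex X).lstar : ℝ) + 1) * (2 * (thetaIndex X).lstar + 1) / 6 - 1) *
            ∑ pp ∈ U, (mq pp : ℝ) * Real.log (pp : ℕ) ≤
          (((absRamificationIdx (p₀ : ℕ) (RescaledCompletion (CyclotomicField 28 ℚ) (p₀ : ℕ) v₀ hvp₀) : ℝ) - 1) /
              (absRamificationIdx (p₀ : ℕ) (RescaledCompletion (CyclotomicField 28 ℚ) (p₀ : ℕ) v₀ hvp₀) : ℝ)) *
            ((((thetaIndex X).lstar : ℝ) + 1) / 2) * Real.log (p₀ : ℕ)) := by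
  classical
  refine ⟨exists_sq_eq_neg_one_cyclotomicField_twentyEight, ?_⟩
  set K := CyclotomicField 28 ℚ with hK
  haveI hcyc : IsCyclotomicExtension {28} ℚ K := CyclotomicField.isCyclotomicExtension 28 ℚ
  haveI h3 : Fact (Nat.Prime 3) := ⟨Nat.prime_three⟩
  haveI h7 : Fact (Nat.Prime 7) := ⟨by norm_num⟩
  haveI hGal : IsGalois ℚ K := IsCyclotomicExtension.isGalois {28} ℚ K
  -- `ord_v(j_E) = −10·e_v < 0` at every place over `3`
  have hord3 : ∀ v ∈ placesOver K 3, ord K v ((((3 : ℕ) : K) ^ 10)⁻¹) = -(10 * (ramIdx K v : ℤ)) := by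
    intro v hv
    rw [ord_inv, ord_pow, Cor22.ord_natCast_eq_ramIdx 3 v hv]
    push_cast
    ring
  let X : PilotData K :=
    { jE := ((((3 : ℕ) : K) ^ 10)⁻¹)
      S := placesOver K 3
      S_nonempty := placesOver_nonempty K 3
      ord_jE_neg := fun v hv => by
        rw [hord3 v hv]
        have hpos : 0 < (ramIdx K v : ℤ) := by exact_mod_cast Nat.pos_of_ne_zero (ramIdx_ne_zero K v)
        linarith
      l := 5
      l_prime := by norm_num
      five_le_l := le_rfl }
  have hlstar : (thetaIndex X).lstar = 2 := by
    show (5 - 1) / 2 = 2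
    norm_num
  -- the place over `7`
  obtain ⟨v₀, hv₀mem⟩ := placesOver_nonempty K 7
  have hres₀ : residueChar K v₀ = 7 := (mem_placesOver_iff_residueChar v₀).mp hv₀mem
  have hvp₀ : ((7 : ℕ) : 𝓞 K) ∈ v₀.asIdeal := by
    have h := natCast_residueChar_mem K v₀
    rwa [hres₀] at h
  have hv₀ : (thetaIndex X).over (.inr v₀) = .inr ⟨7, h7.out⟩ := by
    show (Sum.inr ⟨residueChar K v₀, residueChar_prime K v₀⟩ : Thm311.Real.RatPlace) = Sum.inr ⟨7, h7.out⟩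
    congr 1
    exact Subtype.ext hres₀
  -- `7 = 7¹·(28/4)`: `e = 6`, `f = ord(7 mod 4) = 2`, one place (fundamental identity `g·e·f = [F:ℚ] = 12`)
  have h28 : 28 = 7 ^ (0 + 1) * 4 := by norm_num
  have h74 : ¬ 7 ∣ 4 := by norm_num
  have horder : orderOf ((7 : ℕ) : ZMod 4) = 2 := by
    rw [Nat.cast_ofNat]
    exact orderOf_eq_prime (by decide) (by decide)
  have hncard : (Ideal.primesOver (Ideal.span {((7 : ℕ) : ℤ)}) (𝓞 K)).ncard = 1 := by
    have hfund := Ideal.ncard_primesOver_mul_ramificationIdxIn_mul_inertiaDegIn (Ideal.span {((7 : ℕ) : ℤ)}) (𝓞 K) (K ≃ₐ[ℚ] K)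
    rw [IsCyclotomicExtension.Rat.ramificationIdxIn_eq 28 K h28 h74, IsCyclotomicExtension.Rat.inertiaDegIn_eq 28 K h28 h74, horder,
      IsGalois.card_aut_eq_finrank, IsCyclotomicExtension.Rat.finrank 28 K, show Nat.totient 28 = 12 by decide,
      show 7 ^ 0 * (7 - 1) * 2 = 12 by norm_num] at hfund
    omega
  obtain ⟨P₀, hP₀⟩ := Set.ncard_eq_one.mp hncard
  have hmemP : ∀ w ∈ placesOver K 7, w.asIdeal ∈ Ideal.primesOver (Ideal.span {((7 : ℕ) : ℤ)}) (𝓞 K) := fun w hw =>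
    ⟨w.isPrime, (mem_placesOver_iff w).mp hw⟩
  have huniq : ∀ w ∈ placesOver K 7, w = v₀ := fun w hw => by
    refine HeightOneSpectrum.ext ?_
    have h1 := hmemP w hw
    have h2 := hmemP v₀ hv₀mem
    rw [hP₀, Set.mem_singleton_iff] at h1 h2
    rw [h1, h2]
  have he₀ : absRamificationIdx 7 (RescaledCompletion K 7 v₀ hvp₀) = 6 := by
    haveI : v₀.asIdeal.LiesOver (Ideal.span {((7 : ℕ) : ℤ)}) := (mem_placesOver_iff v₀).mp hv₀mem
    rw [absRamificationIdx_rescaledCompletion K 7 v₀ hvp₀,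
      IsCyclotomicExtension.Rat.ramificationIdx_eq 28 K (P := v₀.asIdeal) h28 h74]
    norm_num
  -- `3 ∤ 28` is unramified in `ℚ(ζ₂₈)`: `3 ∤ disc F`
  have hUd3 : ¬ ((3 : ℕ) : ℤ) ∣ NumberField.discr K := by
    have hp3 : Prime ((3 : ℕ) : ℤ) := Nat.prime_iff_prime_int.mp Nat.prime_three
    refine (NumberField.not_dvd_discr_iff_forall_liesOver K (𝓞 K) hp3).mpr fun Q hQ hQ3 => ?_
    haveI := hQ
    haveI := hQ3
    exact Ideal.ramificationIdx_eq_one_iff.mp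
      (IsCyclotomicExtension.Rat.ramificationIdx_eq_of_not_dvd (p := 3) (K := K) Q (by norm_num : ¬ 3 ∣ 28))
  refine ⟨X, {⟨3, Nat.prime_three⟩}, fun _ => 1, ⟨7, h7.out⟩, v₀, hv₀, hvp₀, ?_, ?_, ?_, ?_, ?_, ?_, huniq, ?_⟩
  · -- bad places lie over `3`
    intro pp x hx
    haveI : Fact (pp : ℕ).Prime := ⟨pp.2⟩
    have hres : residueChar K (placeOf X pp.1 x) = pp := (mem_placesOver_iff_residueChar _).mp (placeOf_mem X pp.1 x)
    have hx' : placeOf X pp.1 x ∈ placesOver K 3 := hx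
    have h3' : residueChar K (placeOf X pp.1 x) = 3 := (mem_placesOver_iff_residueChar _).mp hx'
    have : pp = ⟨3, Nat.prime_three⟩ := Subtype.ext (hres.symm.trans h3')
    simp [this]
  · -- every place over `3` is bad
    intro pp hpp x
    haveI : Fact (pp : ℕ).Prime := ⟨pp.2⟩
    rw [Finset.mem_singleton] at hpp
    subst hpp
    exact placeOf_mem X 3 x
  · intro pp hpp
    rw [Finset.mem_singleton] at hpp; subst hpp; norm_num
  · intro pp hpp
    rw [Finset.mem_singleton] at hpp; subst hpp
    exact hUd3
  · -- `ord_v(q_v) = 10·e_v = 2·l·e_v·1`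
    intro pp hpp x
    haveI : Fact (pp : ℕ).Prime := ⟨pp.2⟩
    rw [Finset.mem_singleton] at hpp
    subst hpp
    have hx : placeOf X 3 x ∈ placesOver K 3 := placeOf_mem X 3 x
    show ((-ord K (placeOf X 3 x) ((((3 : ℕ) : K) ^ 10)⁻¹) : ℤ) : ℝ) = 2 * ((5 : ℕ) : ℝ) * ramIdx K (placeOf X 3 x) * ((1 : ℕ) : ℝ)
    rw [hord3 _ hx]
    push_cast
    ring
  · show 2 ≤ absRamificationIdx 7 (RescaledCompletion K 7 v₀ hvp₀)
    rw [he₀]; norm_num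
  · show ((((thetaIndex X).lstar : ℝ) + 1) * (2 * (thetaIndex X).lstar + 1) / 6 - 1) *
        ∑ pp ∈ ({⟨3, Nat.prime_three⟩} : Finset Nat.Primes), ((1 : ℕ) : ℝ) * Real.log (pp : ℕ) ≤
      (((absRamificationIdx 7 (RescaledCompletion K 7 v₀ hvp₀) : ℝ) - 1) /
          (absRamificationIdx 7 (RescaledCompletion K 7 v₀ hvp₀) : ℝ)) * ((((thetaIndex X).lstar : ℝ) + 1) / 2) *
        Real.log ((7 : ℕ) : ℝ)
    rw [he₀, hlstar, Finset.sum_singleton]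
    have h := three_halves_log_three_le_five_fourths_log_seven
    push_cast
    norm_num
    linarith

/-- **THE CONVERSE OF Y-21ℓ IS REFUTED AT GENUINE TAME DATA WITH REALISING IDELES OVER A BASE FIELD CONTAINING `√−1` — assembled.**
Over `F = ℚ(ζ₂₈)` (`√−1 ∈ F`) there is a pilot datum (`j_E := 3^{−10}`, `S := V(F)₃`, `l := 5`) and a finite set `s` of rational places such
that for EVERY Thm-3.11 context: pilot ideles REALISING `P_Θ`, `P_q` in print's normalisation EXIST (non-zero, units off `S`), and for ALL
such ideles **OUR typed [IUTchIII] Cor. 3.12 `Statement` HOLDS at abc-iut-c312-7's genuine `Real.settingPrVolSharp`, while [J-III]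
Cor 9.11.1.1 read through the dictionary FAILS (`¬ A.Cor91111`) for EVERY adelic Θ-values-locus datum `A` on `s` reading the genuine
`q`-volumes and hull volumes — and such a reading datum exists.** No side taken: the Statement holds here BY (Ind1)/(Ind2)-INFLATION of the
unit boxes at the `7`-packets (quantitative ramified hull gain, parts I–II), «saying nothing about print's intended content».
[cite: Mochizuki2012, IUTchI Def. 3.1 (a) p. 61] [claim: Joshi2024ATS3, status: disputed] [claim: Mochizuki2012, status: disputed]
[cite: DupuyHilado2025, §3.3, §3.4, §3.6, §3.9, §4.7, §4.9] -/
theorem exists_realising_statement_and_not_cor91111_cyclotomicField_twentyEight :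
    (∃ r : CyclotomicField 28 ℚ, r ^ 2 = -1) ∧
    ∃ (X : PilotData (CyclotomicField 28 ℚ)) (s : Finset (thetaIndex X).VQ),
      ∀ {logv : PadicLogs (CyclotomicField 28 ℚ)} (hlog : LogvAnalytic logv) (M : Type) [Field M] [NumberField M]
        (archPk : ∀ (j : (thetaIndex X).Label) (vQ : (thetaIndex X).VQ), Set ((logShellsDH X logv).Packet j vQ))
        (archSub : ∀ (j : (thetaIndex X).Label) (v : (thetaIndex X).V),
          Set ((logShellsDH X logv).Packet j ((thetaIndex X).over v)))
        (Ψ : ℤ → ∀ v : (thetaIndex X).V, v ∈ (thetaIndex X).Vbad → Set ((logShellsDH X logv).StarPacket v))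
        (act : ℤ → ∀ v : (thetaIndex X).V, v ∈ (thetaIndex X).Vbad →
          (logShellsDH X logv).StarPacket v → Module.End ℚ ((logShellsDH X logv).StarPacket v))
        (Mmod : ℤ → ∀ j : (thetaIndex X).LabelStar, Set ((logShellsDH X logv).GlobalPacket j.1))
        (region : ℤ → ∀ j : (thetaIndex X).LabelStar, FinDivisor M → ∀ vQ : (thetaIndex X).VQ,
          Set ((logShellsDH X logv).Packet j.1 vQ))
        (n : ℤ) {HT : Type} {LogLink : HT → HT → Type} {IsFull : ∀ {s t : HT}, LogLink s t → Prop}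
        (lat : LGPGaussianLogThetaLattice LogLink IsFull)
        {Frd : Type} {IsoF : Frd → Frd → Type} {Ob : Frd → Type} {realify : Frd → Frd} {Strip : Type}
        {IsoS : Strip → Strip → Type} {Mv : ∀ v : (thetaIndex X).V, v ∈ (thetaIndex X).Vbad → Type}
        [∀ v h, Monoid (Mv v h)]
        (sig : GlobalLGPFrobenioidSignature (thetaIndex X).lstar (thetaIndex X).V (· ∈ (thetaIndex X).Vbad)
          Frd IsoF Ob realify Strip IsoS Mv)
        (split : SplittingMonoids Mv) {ObΔ : Type} {N : ∀ v : (thetaIndex X).V, v ∈ (thetaIndex X).Vbad → Type}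
        [∀ v h, Monoid (N v h)] (qData : QPilotData ObΔ N),
      (∃ (tq : ∀ (pp : Nat.Primes) (x : (thetaIndex X).Fibre (.inr pp)), haveI : Fact (pp : ℕ).Prime := ⟨pp.2⟩; kOf X pp.1 x)
          (t : ∀ (pp : Nat.Primes) (_ : Fin X.lstar) (x : (thetaIndex X).Fibre (.inr pp)),
            haveI : Fact (pp : ℕ).Prime := ⟨pp.2⟩; kOf X pp.1 x),
          (∀ pp x, tq pp x ≠ 0) ∧
          (∀ (pp : Nat.Primes) (x : (thetaIndex X).Fibre (.inr pp)),
            haveI : Fact (pp : ℕ).Prime := ⟨pp.2⟩; placeOf X pp.1 x ∉ X.S → ‖tq pp x‖ = 1) ∧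
          (∀ pp i x, t pp i x ≠ 0) ∧
          (∀ (pp : Nat.Primes) (i : Fin X.lstar) (x : (thetaIndex X).Fibre (.inr pp)),
            haveI : Fact (pp : ℕ).Prime := ⟨pp.2⟩; placeOf X pp.1 x ∉ X.S → ‖t pp i x‖ = 1) ∧
          (∀ (pp : Nat.Primes) (i : Fin X.lstar) (x : (thetaIndex X).Fibre (.inr pp)),
            haveI : Fact (pp : ℕ).Prime := ⟨pp.2⟩;
            Real.log ‖t pp i x‖ = -(X.thetaPilot i (placeOf X pp.1 x)) * logNorm (CyclotomicField 28 ℚ) (placeOf X pp.1 x) /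
              localDegree (CyclotomicField 28 ℚ) (placeOf X pp.1 x)) ∧
          (∀ (pp : Nat.Primes) (x : (thetaIndex X).Fibre (.inr pp)),
            haveI : Fact (pp : ℕ).Prime := ⟨pp.2⟩;
            Real.log ‖tq pp x‖ = -(X.qPilot (placeOf X pp.1 x)) * logNorm (CyclotomicField 28 ℚ) (placeOf X pp.1 x) /
              localDegree (CyclotomicField 28 ℚ) (placeOf X pp.1 x))) ∧
      ∀ (tq : ∀ (pp : Nat.Primes) (x : (thetaIndex X).Fibre (.inr pp)), haveI : Fact (pp : ℕ).Prime := ⟨pp.2⟩; kOf X pp.1 x)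
        (t : ∀ (pp : Nat.Primes) (_ : Fin X.lstar) (x : (thetaIndex X).Fibre (.inr pp)),
          haveI : Fact (pp : ℕ).Prime := ⟨pp.2⟩; kOf X pp.1 x)
        (htq0 : ∀ pp x, tq pp x ≠ 0)
        (htq1 : ∀ (pp : Nat.Primes) (x : (thetaIndex X).Fibre (.inr pp)),
          haveI : Fact (pp : ℕ).Prime := ⟨pp.2⟩; placeOf X pp.1 x ∉ X.S → ‖tq pp x‖ = 1)
        (_ : ∀ pp i x, t pp i x ≠ 0)
        (_ : ∀ (pp : Nat.Primes) (i : Fin X.lstar) (x : (thetaIndex X).Fibre (.inr pp)),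
          haveI : Fact (pp : ℕ).Prime := ⟨pp.2⟩; placeOf X pp.1 x ∉ X.S → ‖t pp i x‖ = 1)
        (_ : ∀ (pp : Nat.Primes) (i : Fin X.lstar) (x : (thetaIndex X).Fibre (.inr pp)),
          haveI : Fact (pp : ℕ).Prime := ⟨pp.2⟩;
          Real.log ‖t pp i x‖ = -(X.thetaPilot i (placeOf X pp.1 x)) * logNorm (CyclotomicField 28 ℚ) (placeOf X pp.1 x) /
            localDegree (CyclotomicField 28 ℚ) (placeOf X pp.1 x))
        (_ : ∀ (pp : Nat.Primes) (x : (thetaIndex X).Fibre (.inr pp)),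
          haveI : Fact (pp : ℕ).Prime := ⟨pp.2⟩;
          Real.log ‖tq pp x‖ = -(X.qPilot (placeOf X pp.1 x)) * logNorm (CyclotomicField 28 ℚ) (placeOf X pp.1 x) /
            localDegree (CyclotomicField 28 ℚ) (placeOf X pp.1 x)),
        (settingPrVolSharp X hlog M archPk archSub Ψ act Mmod region n lat sig split qData tq t htq0 htq1).Statement ∧
          (∀ A : ATS3.AdelicLocusDatum (thetaIndex X).lstar s,
            (∀ (i : Fin (thetaIndex X).lstar) (w : s), Real.log (A.loc w).qroot =
              (settingPrVolSharp X hlog M archPk archSub Ψ act Mmod region n lat sig split qData tq t htq0 htq1).qLocal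
                (Setting.labelSucc i) w) →
            (∀ w : s, Real.log (A.loc w).hullVol =
              ∑ i : Fin (thetaIndex X).lstar, ((situationPrVol X hlog M archPk archSub Ψ act Mmod region).D n).logvol
                (Setting.labelSucc i) w
                ((settingPrVolSharp X hlog M archPk archSub Ψ act Mmod region n lat sig split qData tq t htq0 htq1).thetaHull
                  (Setting.labelSucc i) w)) →
            ¬ A.Cor91111) ∧
          ∃ A : ATS3.AdelicLocusDatum (thetaIndex X).lstar s,
            (∀ (i : Fin (thetaIndex X).lstar) (w : s), Real.log (A.loc w).qroot =
              (settingPrVolSharp X hlog M archPk archSub Ψ act Mmod region n lat sig split qData tq t htq0 htq1).qLocal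
                (Setting.labelSucc i) w) ∧
            (∀ w : s, Real.log (A.loc w).hullVol =
              ∑ i : Fin (thetaIndex X).lstar, ((situationPrVol X hlog M archPk archSub Ψ act Mmod region).D n).logvol
                (Setting.labelSucc i) w
                ((settingPrVolSharp X hlog M archPk archSub Ψ act Mmod region n lat sig split qData tq t htq0 htq1).thetaHull
                  (Setting.labelSucc i) w)) := by
  classical
  obtain ⟨hsqrt, X, U, mq, p₀, v₀, hv₀, hvp₀, hU, hUS, hU2, hUd, hord, he₀, huniq₀, hnum⟩ :=
    exists_pilotData_cyclotomicField_twentyEight_realising_hypotheses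
  refine ⟨hsqrt, ?_⟩
  set sU : Finset (thetaIndex X).VQ :=
    U.map ⟨fun pp => (Sum.inr pp : (thetaIndex X).VQ), fun _ _ h => Sum.inr_injective h⟩ with hsU
  have hs : ∀ w : (thetaIndex X).VQ, w ∈ sU ↔ ∃ pp ∈ U, w = Sum.inr pp := fun w => by
    rw [hsU, Finset.mem_map]
    exact ⟨fun ⟨pp, hpp, h⟩ => ⟨pp, hpp, h.symm⟩, fun ⟨pp, hpp, h⟩ => ⟨pp, hpp, h.symm⟩⟩
  refine ⟨X, sU, ?_⟩
  intro logv hlog M _ _ archPk archSub Ψ act Mmod region n HT LogLink IsFull lat Frd IsoF Ob realify Strip IsoS Mv _ sig split ObΔ N _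
    qData
  refine ⟨?_, fun tq t htq0 htq1 ht0 ht1 ht htq => ?_⟩
  · obtain ⟨tq, t, htq0, htq1, ht0, ht1, ht, htq⟩ := exists_realising_ideles X U hU hUS mq hord
    exact ⟨tq, t, htq0, htq1, ht0, ht1, ht, htq⟩
  · exact statement_and_not_cor91111_of_realising X hlog M archPk archSub Ψ act Mmod region n lat sig split qData U hU hUS hU2 hUd mq
      hord t tq ht0 ht1 htq0 htq1 ht htq p₀ v₀ hv₀ hvp₀ he₀ huniq₀ hnum sU hs

end TestATS4LowerBound

end Summit.ABC.IUTFork.Joshi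

end
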